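import Literature.MathematicalPhysics.QuantumFieldTheory.Balaban1983to89.Beta.ResolventCompositionStepB
import Literature.MathematicalPhysics.QuantumFieldTheory.Balaban1983to89.Beta.BiLaplaceBlockGreen

/-!
# `BalabanUV.Beta.FP.GaugeMultiplierBiLaplace` — road «FP» for binder row D1, sub-row **MS-1-GAUGE residual (a), FORCE LEG** (owner d1-p3 gen 13,
# `LEAVES-FP.md` l.563): **THE GAUGE MULTIPLIER OF THE TYPED FLUCTUATION COVARIANCE IS, IN ITS FORCE LEG, MINUS THE GRADIENT OF an2's BLOCK-CONSTRAINED
# BI-LAPLACIAN GREEN KERNEL** — `GamM_N(z; l, x′) = −(Sb_N(x′ + e_l, z) − Sb_N(x′, z))`, every `d`, every `N ≥ 1`; hence the force leg is PURE GAUGE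
# (curl-free), is killed by `𝒬_N`, and its gauge quantity `δdδ` is `−(δ⁰_z + Wb)` exactly; with the Faddeev–Popov duality identity it comes from and
# the `M`-block sums that road FP's two-level defect consumes — UNCONDITIONAL

HONEST DEPENDENCY (page 1, mandatory): continuum YM on T⁴ ⇐ BetaPertH ∧ nine spine estimates (0/9 proved); BetaPertH ⇐ (D1) ∧ (D4) ∧ CAP+tail;
G-an2-4 gates asym, D1 and NE2/3/4.  HONEST FRAMING (cell contract, verbatim): «discharging `BetaPertH` makes Bałaban's UV stability UNCONDITIONAL —
a real constructive-QFT result; it is NOT the continuum limit and NOT the Clay problem.»  THIS MODULE is [folklore]-grade linear algebra on the cell's OWN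
typed `U = 1` KKT system (`KKTFluctuationUnique.SolvesKKT`: (EL) `d*dA = 𝒬ᵀφ + d(δdμ) + F`, (G) `δdδA ∈ BC_N`, (M) zero block sums of `μ`, (Q)) and an2's
block-constrained inverse of the squared Laplacian (`BiLaplaceBlockKKT.Sb`, `BiLaplaceBlockGreen`: (EL_b) `L(L S_{x′}) = Wb∘quo + δ_{x′}`, (M_b) zero
block sums, `L = codiff₁∘dz`); every input BY NAME.  No `def`, no `def … : Prop`, nothing cited, 0 sorry; 0 estimates of Bałaban's constrained objects;
0∕4 row-D1 binders; NOT the two-level closed form (next module), NOT the perfect level, NOT (STEP)∕SDF, NOT D1, NOT BetaPertH, NOT continuum, NOT Clay.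
«not in print; our bookkeeping».  RELATED IN TREE (different statement): road BF-x's dictionary brick B7 (`D1BFx/LandauDictionaryGamma(Readout)`,
d1-formalise-leaf-06 g6) uses `Sb` as the pure-gauge CORRECTOR of a force-driven column under the DISPLAYED hypothesis X₁a and reads `Γ^M` through
the smoothed-gauge operators `G′R`; the identity below is hypothesis-free and concerns `Γ^M = GamM` alone.
ABSOLUTE RULE (cell charter, verbatim): «No internally-minted statement may enter as a cited fact. Every hypothesis is either kernel-proved in this package or a
verbatim quotation of a PUBLISHED theorem with page reference. The manuscript(s) under audit are NOT citable for their own disputed steps — they are the thing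
under adjudication; programme-internal (2001/route/tribunal) claims are never citable.»

WHY (owner's located reading, gen 13; toy-certified to 1e-14 on periodised tori, jobs j132676 ∕ j132700).  The typed gauge condition (G)+(M) says
`A ⟂ dz(δdμ)` for every `μ` with zero `N`-block sums, so the Faddeev–Popov operator of the typed slice is `P_N L² P_N` on the zero-block-mean 0-forms —
EXACTLY the operator an2 inverted as `Sb` — and three adjunctions on (EL) show that the gauge multiplier of a covariance field reads ONLY the divergence of
its force: `μ_F(z) = −Σ_x Sb(x, z)·(codiff₁ F)(x)` (an5's `McolSum_eq_zero` is the co-closed case, an2-g15's `…_of_isBlockConst` the block-constant one).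
Road FP's two-level gauge-slice defect (`TwoLevelGaugeDefect`, `PerfectGaugeDefect(Bottom)`, `TwoLevelDefectFormula`) is built from the `M`-block sums
`β_y(b) = Σ_{z ∈ B_M(y)} GamM_{N′}(z; b)` of these force legs; §4 gives them as `−dz θ_y`, `θ_y = Σ_{z ∈ B_M(y)} Sb_{N′}(·, z)`, with the three properties
the closed form `E = Σ_y (C_y ⊗ β_y + β_y ⊗ C_y)` (next module) consumes.

CONTENT (all `d`, `N ≥ 1`).
* §1 `lip0_δS`, `lip0_codiff₁_δcol`, **`lip0_gaugeMult_eq_neg_lip0_codiff₁`** (FADDEEV–POPOV DUALITY, abstract): if `(U, Φ, μ)` satisfy (EL) with force `a`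
  and (M), and `θ` is bounded with summable `dz θ`, `contourSum N (dz θ) = 0`, `L(Lθ) = h + s` with `h` block-constant, then `⟨μ, s⟩ = −⟨θ, codiff₁ a⟩`.
* §2 **`Mcol_eq_neg_dz_SbCol`**: `Mcol_N l x′ z = −(dz (SbCol_N z)) l x′`; `forceLeg_eq_dz` (the force leg `(l,x′) ↦ GamM_N(z;l,x′)` IS `dz(−SbCol_N z)`).
* §3 **`curv_forceLeg`** (`= 0`), **`contourSum_forceLeg`** (`= 0`), **`gaugeObs_forceLeg`** (`δdδ = −(WbAdj z + δS z)`), `McolSum_apply` (finite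
  combinations: `μ_{Σa δ}(z) = −Σ_b a_b (dz SbCol_N z)(b)`).
* §4 `M`-block sums at level `N′`: **`blockSum_Mcol_eq_neg_dz`** (`β_y = −dz θ_y`), `theta_bdd_summable`, `blockSum_theta`, `contourSum_dz_theta`,
  `lapLap_theta`, `indicatorSum_apply`, `isBlockConst_indicatorSum`; for `N′ = M·L` **`isBlockConst_gaugeObs_blockSumMcol`**, **`curv_blockSumMcol`**.
Provenance: road «FP» OWNER, unit b2b-balaban-beta-d1-p3 gen 13 (prover-b2b-balaban-beta-d1-p3-g13-0), 2026-08-21; no existing file touched.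
-/

noncomputable section

namespace Summit.QuantumFields.BalabanUV.Beta.FP.GaugeMultiplierBiLaplace

open Finset
open scoped BigOperators
open Literature.MathematicalPhysics.QuantumFieldTheory
open Literature.MathematicalPhysics.QuantumFieldTheory.Balaban1983to89
open Literature.MathematicalPhysics.QuantumFieldTheory.Balaban1983to89.Beta
open B12Sec2to5 (l1 l1_nonneg Decay510)
open AffineAveraging (Form0 Form1 Form2 unitVec unitVec_apply dz curv curvAdj codiff₁ box toSite blockSum contourSum curv_dz contourSum_dz)
open AffineReproduction (contourSumAdj IsBlockConst dz_add)
open LatticeForm (repZ quo)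
open KernelSpecInstance (codiff₁_add codiff₁_smul dz_smul)
open KKTFluctuationKernel (Gam GamM Gam_Q GamM_M)
open KKTFluctuationEnergy (lip0 lip1 lip2 lip1_curvAdj lip1_dz lip0_codiff₁ lip1_add lip1_contourSumAdj summable_mul_of_bdd summable_mul_of_bdd'
  abs_dz_le abs_codiff₁_le summable_dz summable_codiff₁ summable_curv tsum_mul_eq_zero_of_blockConst quo_zsmul_add_toSite
  Gcol Mcol Φcol δcol curvAdj_curv_Gcol Gcol_bdd_summable Mcol_bdd_summable Φcol_bdd)
open ResolventComposition (δSum McolSum isBlockConst_of_mul quo_zsmul')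
open ResolventCompositionStepB (summable_δcol lip1_δcol_left dz_finsum_mul codiff₁_finsum_mul)
open ScalarBlockGreen (lip1_comm lip0_comm δS)
open BiLaplaceBlockKKT (Sb Wb)
open BiLaplaceBlockGreen (SbCol WbAdj lapLapN_SbCol blockSum_SbCol SbCol_bdd_summable WbAdj_bdd isBlockConst_WbAdj Sb_symm)
open BlochFibreMatrix (eq_repZ_add_zsmul_quo)

variable {d : ℕ} {N : ℕ}

/-! ## §1 The Faddeev–Popov duality identity -/

section Duality

/-- [folklore] Pairing with a point mass on the right evaluates. -/
theorem lip0_δS (f : Form0 (d + 1) ℝ) (z : AffineAveraging.Site (d + 1)) : lip0 f (δS z) = f z := by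
  unfold KKTFluctuationEnergy.lip0 ScalarBlockGreen.δS
  rw [tsum_eq_single z]
  · simp
  · intro x hx
    simp [hx]

/-- [folklore] Pairing a bounded 0-form with the divergence of the unit force `δ_{(l,x′)}` gives its forward difference at the force bond:
`⟨θ, codiff₁ δ_{(l,x′)}⟩ = θ(x′ + e_l) − θ(x′)`. -/
theorem lip0_codiff₁_δcol {θ : Form0 (d + 1) ℝ} {Θ : ℝ} (hθ : ∀ x, |θ x| ≤ Θ) (l : Fin (d + 1)) (x' : AffineAveraging.Site (d + 1)) :
    lip0 θ (codiff₁ (δcol l x')) = dz θ l x' := by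
  rw [lip0_codiff₁ hθ (summable_δcol l x'), lip1_comm, lip1_δcol_left]

variable [NeZero N]

/-- [our proof] **FADDEEV–POPOV DUALITY FOR THE TYPED `U = 1` GAUGE SLICE.**  Let `(U, Φ, μ)` satisfy the Euler–Lagrange identity
`d*dU = 𝒬ᵀ_N Φ + dz(δdμ) + a` with zero `N`-block sums of `μ` (bounds: `U`, `a` summable componentwise, `Φ`, `μ` bounded, `μ` summable).  Let `θ` be a
GAUGE POTENTIAL OF THE TEST FUNCTION `s`: bounded, `dz θ` summable, `contourSum N (dz θ) = 0` (the gauge transformation `dz θ` is invisible to the block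
averages) and `L(Lθ) = h + s` with `h` bounded and `N`-block-constant (`L = codiff₁∘dz`).  Then `⟨μ, s⟩ = −⟨θ, codiff₁ a⟩`: the gauge multiplier reads
ONLY the divergence of the force.  Proof: pair (EL) with `dz θ`; `⟨d*dU, dzθ⟩ = ⟨curv U, curv dzθ⟩ = 0`, `⟨𝒬ᵀΦ, dzθ⟩ = ⟨Φ, 𝒬 dzθ⟩ = 0`,
`⟨dz δd μ, dzθ⟩ = ⟨μ, L(Lθ)⟩ = ⟨μ, s⟩ + 0` ((M) against the block-constant `h`), `⟨a, dzθ⟩ = ⟨codiff₁ a, θ⟩`. -/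
theorem lip0_gaugeMult_eq_neg_lip0_codiff₁ {U Φ a : Form1 (d + 1) ℝ} {μ θ s h : Form0 (d + 1) ℝ} {K Θ : ℝ}
    (hUs : ∀ κ, Summable (U κ)) (hΦb : ∀ κ y, |Φ κ y| ≤ K) (hμb : ∀ z, |μ z| ≤ K) (hμs : Summable μ) (has : ∀ κ, Summable (a κ))
    (hM : ∀ y, blockSum N μ y = 0) (hEL : curvAdj (curv U) = contourSumAdj N Φ + dz (codiff₁ (dz μ)) + a)
    (hθb : ∀ x, |θ x| ≤ Θ) (hθs : ∀ κ, Summable (dz θ κ)) (hθQ : contourSum N (dz θ) = 0)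
    (hθL : codiff₁ (dz (codiff₁ (dz θ))) = h + s) (hh : IsBlockConst N h) (hhb : ∀ x, |h x| ≤ K) (hsb : ∀ x, |s x| ≤ K) :
    lip0 μ s = -lip0 θ (codiff₁ a) := by
  -- bounds on the derivatives of `θ`
  have b1 : ∀ κ x, |dz θ κ x| ≤ 2 * Θ := fun κ x => abs_dz_le hθb κ x
  have b2 : ∀ x, |codiff₁ (dz θ) x| ≤ (d + 1 : ℕ) * (2 * (2 * Θ)) := fun x => abs_codiff₁_le b1 x
  have b3 : ∀ κ x, |dz (codiff₁ (dz θ)) κ x| ≤ 2 * ((d + 1 : ℕ) * (2 * (2 * Θ))) := fun κ x => abs_dz_le b2 κ x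
  -- summabilities on the KKT side
  have sdzμ : ∀ κ, Summable (dz μ κ) := fun κ => summable_dz hμs κ
  have sLμ : Summable (codiff₁ (dz μ)) := summable_codiff₁ sdzμ
  have hμLb : ∀ κ x, |dz (codiff₁ (dz μ)) κ x| ≤ 2 * ((d + 1 : ℕ) * (2 * (2 * K))) :=
    fun κ x => abs_dz_le (fun z => abs_codiff₁_le (fun κ w => abs_dz_le hμb κ w) z) κ x
  -- (0) the curvature term dies: `⟨dzθ, d*dU⟩ = ⟨curv dzθ, curv U⟩ = 0`
  have e0 : lip1 (dz θ) (curvAdj (curv U)) = 0 := by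
    rw [lip1_curvAdj b1 (fun κ l => summable_curv hUs κ l), curv_dz]
    simp [KKTFluctuationEnergy.lip2]
  -- (1) the constraint term dies: `⟨dzθ, 𝒬ᵀΦ⟩ = Σ Φ·𝒬(dzθ) = 0`
  have e1 : lip1 (dz θ) (contourSumAdj N Φ) = 0 := by
    rw [lip1_contourSumAdj (N := N) hθs hΦb, hθQ]
    simp
  -- (2) the gauge term: `⟨dzθ, dz δd μ⟩ = ⟨L(Lθ), μ⟩ = ⟨h + s, μ⟩ = ⟨μ, s⟩`
  have e2 : lip1 (dz θ) (dz (codiff₁ (dz μ))) = lip0 μ s := by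
    rw [lip1_dz b1 sLμ, lip0_codiff₁ b2 sdzμ, lip1_dz b3 hμs, hθL]
    unfold KKTFluctuationEnergy.lip0
    have sh : Summable (fun x => h x * μ x) := summable_mul_of_bdd hhb hμs
    have ss : Summable (fun x => s x * μ x) := summable_mul_of_bdd hsb hμs
    simp only [Pi.add_apply, add_mul]
    rw [sh.tsum_add ss, tsum_mul_eq_zero_of_blockConst (N := N) hhb hh hμs hM, zero_add]
    exact tsum_congr fun x => mul_comm _ _
  -- (3) the force term: `⟨dzθ, a⟩ = ⟨θ, codiff₁ a⟩`
  have e3 : lip1 (dz θ) a = lip0 θ (codiff₁ a) := by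
    rw [lip0_codiff₁ hθb has]
  -- pair (EL) with `dz θ`
  have sQ : ∀ κ, Summable (fun x => dz θ κ x * contourSumAdj N Φ κ x) :=
    fun κ => summable_mul_of_bdd' (hθs κ) (fun x => KKTFluctuationEnergy.abs_contourSumAdj_le hΦb κ x)
  have sG : ∀ κ, Summable (fun x => dz θ κ x * dz (codiff₁ (dz μ)) κ x) :=
    fun κ => summable_mul_of_bdd' (hθs κ) (hμLb κ)
  have sa : ∀ κ, Summable (fun x => dz θ κ x * a κ x) := fun κ => summable_mul_of_bdd (b1 κ) (has κ)
  have sQG : ∀ κ, Summable (fun x => dz θ κ x * (contourSumAdj N Φ + dz (codiff₁ (dz μ))) κ x) := fun κ => by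
    have hs := (sQ κ).add (sG κ)
    simpa only [Pi.add_apply, mul_add] using hs
  have h0 := e0
  rw [hEL, lip1_add sQG sa, lip1_add sQ sG, e1, e2, e3, zero_add] at h0
  linarith

end Duality

/-! ## §2 The identification `GamM_N(z; l, x′) = −(dz SbCol_N z)(l, x′)` -/

section Identification

variable [NeZero N]

/-- [our proof] **THE GAUGE MULTIPLIER OF THE TYPED FLUCTUATION COVARIANCE IS MINUS THE FORCE-LEG GRADIENT OF an2's BI-LAPLACIAN BLOCK GREEN KERNEL**:
for every `N ≥ 1`, every source bond `(l, x′)` and every fine site `z`, `Mcol_N l x′ z (= GamM_N(z; l, x′)) = −(Sb_N(x′ + e_l, z) − Sb_N(x′, z))`.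
The duality identity of §1 for the covariance column (`curvAdj_curv_Gcol`, `GamM_M`) with the gauge potential `θ = SbCol_N z` of the point mass
`s = δ⁰_z` (an2: `lapLapN_SbCol`, `blockSum_SbCol`, `isBlockConst_WbAdj`), read with `lip0_δS` and `lip0_codiff₁_δcol`. -/
theorem Mcol_eq_neg_dz_SbCol (l : Fin (d + 1)) (x' z : AffineAveraging.Site (d + 1)) :
    Mcol (N := N) l x' z = -(dz (SbCol (N := N) z) l x') := by
  obtain ⟨C, _, hGb, hGs⟩ := Gcol_bdd_summable (N := N) (d := d)
  obtain ⟨CM, _, hMb, hMs⟩ := Mcol_bdd_summable (N := N) (d := d)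
  obtain ⟨CΦ, _, hΦb⟩ := Φcol_bdd (N := N) (d := d)
  obtain ⟨CS, _, hSb, hSs⟩ := SbCol_bdd_summable (N := N) (d := d)
  obtain ⟨CW, _, hWb⟩ := WbAdj_bdd (N := N) (d := d)
  set K : ℝ := C + CM + CΦ + CW + 1 with hK
  have hθQ : contourSum N (dz (SbCol (N := N) z)) = 0 := by
    rw [contourSum_dz]
    have h0 : blockSum N (SbCol (N := N) z) = 0 := funext fun y => blockSum_SbCol (N := N) z y
    rw [h0]
    funext κ y
    simp [dz]
  have h := lip0_gaugeMult_eq_neg_lip0_codiff₁ (N := N) (K := K) (Θ := CS)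
    (U := Gcol (N := N) l x') (Φ := Φcol (N := N) l x') (μ := Mcol (N := N) l x') (a := δcol l x')
    (θ := SbCol (N := N) z) (s := δS z) (h := WbAdj (N := N) z)
    (hGs l x') (fun κ y => (hΦb l x' κ y).trans (by simp [hK]; linarith))
    (fun w => (hMb l x' w).trans (by simp [hK]; linarith)) (hMs l x') (summable_δcol l x')
    (fun y => GamM_M (N := N) l x' y) (curvAdj_curv_Gcol (N := N) l x')
    (hSb z) (fun κ => summable_dz (hSs z) κ) hθQ (lapLapN_SbCol (N := N) z) (isBlockConst_WbAdj (N := N) z)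
    (fun x => (hWb z x).trans (by simp [hK]; linarith))
    (fun x => by
      unfold ScalarBlockGreen.δS
      split_ifs <;> (simp [hK]; linarith))
  rwa [lip0_δS, lip0_codiff₁_δcol (hSb z)] at h

/-- [our proof] The same with the symmetric kernel written source-first: `GamM_N(z; l, x′) = −(Sb_N(z, x′ + e_l) − Sb_N(z, x′))` (`Sb_symm`). -/
theorem GamM_eq_neg_sub_Sb (z : AffineAveraging.Site (d + 1)) (l : Fin (d + 1)) (x' : AffineAveraging.Site (d + 1)) :
    GamM (N := N) z l x' = -(Sb (N := N) z (x' + unitVec l) - Sb (N := N) z x') := by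
  have h := Mcol_eq_neg_dz_SbCol (N := N) l x' z
  unfold KKTFluctuationEnergy.Mcol at h
  rw [h]; simp only [dz, BiLaplaceBlockGreen.SbCol]; rw [Sb_symm (N := N) (x' + unitVec l) z, Sb_symm (N := N) x' z]

/-- [our proof] **THE FORCE LEG IS PURE GAUGE**: as a 1-form in the force bond, `(l, x′) ↦ GamM_N(z; l, x′)` is `dz (−SbCol_N z)`. -/
theorem forceLeg_eq_dz (z : AffineAveraging.Site (d + 1)) :
    (fun l x' => Mcol (N := N) l x' z) = dz (fun u => -SbCol (N := N) z u) := by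
  funext l x'
  rw [Mcol_eq_neg_dz_SbCol]; simp only [dz]; ring

end Identification

/-! ## §3 Consequences in the force leg: curl-free, killed by `𝒬_N`, explicit gauge quantity; finite combinations -/

section ForceLeg

variable [NeZero N]

/-- [our proof] **CURL-FREE**: `curv ((l, x′) ↦ GamM_N(z; l, x′)) = 0`. -/
theorem curv_forceLeg (z : AffineAveraging.Site (d + 1)) : curv (fun l x' => Mcol (N := N) l x' z) = 0 := by
  rw [forceLeg_eq_dz, curv_dz]

/-- [our proof] **KILLED BY THE BLOCK AVERAGES**: `contourSum N ((l, x′) ↦ GamM_N(z; l, x′)) = 0` (`contourSum_dz` + `blockSum_SbCol`). -/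
theorem contourSum_forceLeg (z : AffineAveraging.Site (d + 1)) : contourSum N (fun l x' => Mcol (N := N) l x' z) = 0 := by
  rw [forceLeg_eq_dz, contourSum_dz]
  have h0 : blockSum N (fun u => -SbCol (N := N) z u) = 0 := by
    funext y
    have h := blockSum_SbCol (N := N) z y
    simp only [blockSum] at h ⊢
    rw [Finset.sum_neg_distrib, h, neg_zero]
    rfl
  rw [h0]
  funext κ y
  simp [dz]

/-- [our proof] **THE GAUGE QUANTITY OF THE FORCE LEG, EXACTLY**: `δdδ ((l,x′) ↦ GamM_N(z; l, x′)) = −(WbAdj_N z + δ⁰_z)` — minus the point mass at `z`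
minus an2's block-constant multiplier (`lapLapN_SbCol`). -/
theorem gaugeObs_forceLeg (z : AffineAveraging.Site (d + 1)) :
    codiff₁ (dz (codiff₁ (fun l x' => Mcol (N := N) l x' z))) = fun x => -(WbAdj (N := N) z x + δS z x) := by
  rw [forceLeg_eq_dz, show (fun u => -SbCol (N := N) z u) = (-1 : ℝ) • SbCol (N := N) z from by
    funext u; simp, dz_smul, codiff₁_smul, dz_smul, codiff₁_smul, lapLapN_SbCol]
  funext x
  simp

/-- [our proof] **THE GAUGE MULTIPLIER OF A FINITE COMBINATION OF COVARIANCE COLUMNS** `U = Σ_{b ∈ S} a_b Γ_N(·; b)`: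
`μ_U(z) = −Σ_{b ∈ S} a_b · (dz SbCol_N z)(b)` — the FP formula `μ_F = −Sb ⋆ (codiff₁ F)` on finitely supported forces. -/
theorem McolSum_apply (S : Finset (Fin (d + 1) × AffineAveraging.Site (d + 1))) (a : Fin (d + 1) × AffineAveraging.Site (d + 1) → ℝ)
    (z : AffineAveraging.Site (d + 1)) :
    McolSum (N := N) S a z = -∑ b ∈ S, a b * dz (SbCol (N := N) z) b.1 b.2 := by
  unfold ResolventComposition.McolSum
  rw [← Finset.sum_neg_distrib]
  refine Finset.sum_congr rfl fun b _ => ?_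
  rw [Mcol_eq_neg_dz_SbCol]
  ring

end ForceLeg

/-! ## §4 Block sums over `M`-blocks at level `N′`: `β_y = −dz θ_y`, `θ_y = Σ_{z ∈ B_M(y)} SbCol_{N′} z` -/

section BlockSums

variable {N' : ℕ} [NeZero N'] (M : ℕ)

/-- [our proof] **THE `M`-BLOCK SUMS OF THE GAUGE MULTIPLIER ARE A GRADIENT IN THE FORCE LEG**:
`blockSum M (Mcol_{N′} l x′) y = −(dz θ_y)(l, x′)` with `θ_y = Σ_{b ∈ box M} SbCol_{N′}(M•y + b)`. -/
theorem blockSum_Mcol_eq_neg_dz (l : Fin (d + 1)) (x' y : AffineAveraging.Site (d + 1)) :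
    blockSum M (Mcol (N := N') l x') y
      = -(dz (fun u => ∑ b ∈ box (d + 1) M, SbCol (N := N') ((M : ℤ) • y + toSite b) u) l x') := by
  simp only [blockSum, Mcol_eq_neg_dz_SbCol (N := N'), dz, Finset.sum_neg_distrib, Finset.sum_sub_distrib]

/-- [folklore] The potential `θ_y` is bounded and summable (finite sum of an2's columns). -/
theorem theta_bdd_summable : ∃ C : ℝ, 0 ≤ C ∧
    (∀ (y u : AffineAveraging.Site (d + 1)), |∑ b ∈ box (d + 1) M, SbCol (N := N') ((M : ℤ) • y + toSite b) u| ≤ (box (d + 1) M).card * C)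
    ∧ ∀ y : AffineAveraging.Site (d + 1), Summable (fun u => ∑ b ∈ box (d + 1) M, SbCol (N := N') ((M : ℤ) • y + toSite b) u) := by
  obtain ⟨C, hC, hSb, hSs⟩ := SbCol_bdd_summable (N := N') (d := d)
  refine ⟨C, hC, fun y u => ?_, fun y => summable_sum fun b _ => hSs _⟩
  refine (Finset.abs_sum_le_sum_abs _ _).trans ?_
  refine (Finset.sum_le_sum fun b _ => hSb _ u).trans ?_
  simp

/-- [folklore] `θ_y` has zero `N′`-block sums. -/
theorem blockSum_theta (y y' : AffineAveraging.Site (d + 1)) :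
    blockSum N' (fun u => ∑ b ∈ box (d + 1) M, SbCol (N := N') ((M : ℤ) • y + toSite b) u) y' = 0 := by
  simp only [blockSum]
  rw [Finset.sum_comm]
  refine Finset.sum_eq_zero fun b _ => ?_
  exact blockSum_SbCol (N := N') _ y'

/-- [folklore] Hence `dz θ_y` is invisible to the level-`N′` block averages: `contourSum N′ (dz θ_y) = 0`. -/
theorem contourSum_dz_theta (y : AffineAveraging.Site (d + 1)) :
    contourSum N' (dz (fun u => ∑ b ∈ box (d + 1) M, SbCol (N := N') ((M : ℤ) • y + toSite b) u)) = 0 := by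
  rw [contourSum_dz]
  have h0 : blockSum N' (fun u => ∑ b ∈ box (d + 1) M, SbCol (N := N') ((M : ℤ) • y + toSite b) u) = 0 :=
    funext fun y' => blockSum_theta (N' := N') M y y'
  rw [h0]
  funext κ w
  simp [dz]

/-- [folklore] `L(L θ_y) = Σ_b WbAdj_{N′}(M•y + b) + Σ_b δ⁰_{M•y + b}` (`lapLapN_SbCol`, summed). -/
theorem lapLap_theta (y : AffineAveraging.Site (d + 1)) :
    codiff₁ (dz (codiff₁ (dz (fun u => ∑ b ∈ box (d + 1) M, SbCol (N := N') ((M : ℤ) • y + toSite b) u))))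
      = (fun u => ∑ b ∈ box (d + 1) M, WbAdj (N := N') ((M : ℤ) • y + toSite b) u)
        + fun u => ∑ b ∈ box (d + 1) M, δS ((M : ℤ) • y + toSite b) u := by
  have key : ∀ b : Fin (d + 1) → ℕ, codiff₁ (dz (codiff₁ (dz (SbCol (N := N') ((M : ℤ) • y + toSite b)))))
      = WbAdj (N := N') ((M : ℤ) • y + toSite b) + δS ((M : ℤ) • y + toSite b) := fun b => lapLapN_SbCol (N := N') _
  have e0 : (fun u => ∑ b ∈ box (d + 1) M, SbCol (N := N') ((M : ℤ) • y + toSite b) u)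
      = fun u => ∑ b ∈ box (d + 1) M, (1 : ℝ) * SbCol (N := N') ((M : ℤ) • y + toSite b) u := by
    funext u; simp
  rw [e0, dz_finsum_mul, codiff₁_finsum_mul, dz_finsum_mul, codiff₁_finsum_mul]
  funext u
  simp only [one_mul, Pi.add_apply, ← Finset.sum_add_distrib]
  refine Finset.sum_congr rfl fun b _ => ?_
  have h := congrFun (key b) u
  simpa only [Pi.add_apply] using h

variable [NeZero M]

/-- [folklore] The summed point masses are the indicator of the `M`-block `y`: `Σ_{b ∈ box M} δ⁰_{M•y+b}(u) = [quo M u = y]`. -/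
theorem indicatorSum_apply (y u : AffineAveraging.Site (d + 1)) :
    (∑ b ∈ box (d + 1) M, δS ((M : ℤ) • y + toSite b) u) = if quo M u = y then 1 else 0 := by
  unfold ScalarBlockGreen.δS
  by_cases hu : quo M u = y
  · rw [if_pos hu]
    -- `u = M•y + toSite b₀` for exactly one `b₀ ∈ box`
    have hb₀mem : (fun j => ((Literature.Probability.LatticeModels.Torus.proj M u) j).val) ∈ box (d + 1) M :=
      KKTFluctuationUnique.repZ_mem_box (N := M) _
    have hu_eq : u = (M : ℤ) • y + toSite (fun j => ((Literature.Probability.LatticeModels.Torus.proj M u) j).val) := by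
      have h := eq_repZ_add_zsmul_quo (N := M) u
      rw [hu] at h
      exact h.trans ((add_comm _ _).trans rfl)
    rw [Finset.sum_eq_single (fun j => ((Literature.Probability.LatticeModels.Torus.proj M u) j).val)]
    · rw [if_pos hu_eq]
    · intro b _ hne
      rw [if_neg]
      intro h
      apply hne
      have h2 : toSite b = toSite (fun j => ((Literature.Probability.LatticeModels.Torus.proj M u) j).val) :=
        add_left_cancel (h.symm.trans hu_eq)
      funext j
      have hj := congrFun h2 j
      simp only [toSite] at hj
      exact_mod_cast hj
    · intro h
      exact absurd hb₀mem h
  · rw [if_neg hu]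
    refine Finset.sum_eq_zero fun b hb => ?_
    rw [if_neg]
    intro h
    exact hu (by rw [h, quo_zsmul_add_toSite (N := M) y hb])

/-- [folklore] The block indicator is `M`-block-constant. -/
theorem isBlockConst_indicatorSum (y : AffineAveraging.Site (d + 1)) :
    IsBlockConst M (fun u => ∑ b ∈ box (d + 1) M, δS ((M : ℤ) • y + toSite b) u) := by
  intro y' b' hb'
  simp only [indicatorSum_apply (M := M)]
  rw [quo_zsmul_add_toSite (N := M) y' hb']
  rw [quo_zsmul' (N := M) y']

/-- [our proof] **FOR `N′ = M·L` THE GAUGE QUANTITY OF THE BLOCK-SUMMED FORCE LEG IS `M`-BLOCK-CONSTANT**: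
`δdδ ((l,x′) ↦ blockSum M (Mcol_{N′} l x′) y) = −(Σ_b WbAdj_{N′}(M•y+b) + 𝟙_{B_M(y)})`, an `N′`-block-constant function (hence `M`-block-constant,
`isBlockConst_of_mul`) plus an `M`-block indicator. -/
theorem isBlockConst_gaugeObs_blockSumMcol {L : ℕ} [NeZero L] (hN : N' = M * L) (y : AffineAveraging.Site (d + 1)) :
    IsBlockConst M (codiff₁ (dz (codiff₁ (fun l x' => blockSum M (Mcol (N := N') l x') y)))) := by
  have hrw : (fun l x' => blockSum M (Mcol (N := N') l x') y)
      = (-1 : ℝ) • dz (fun u => ∑ b ∈ box (d + 1) M, SbCol (N := N') ((M : ℤ) • y + toSite b) u) := by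
    funext l x'
    rw [blockSum_Mcol_eq_neg_dz]
    simp
  rw [hrw, codiff₁_smul, dz_smul, codiff₁_smul, lapLap_theta]
  have hW : IsBlockConst M (fun u => ∑ b ∈ box (d + 1) M, WbAdj (N := N') ((M : ℤ) • y + toSite b) u) := by
    subst hN
    refine isBlockConst_of_mul (L := L) ?_
    intro y' b' hb'
    simp only
    exact Finset.sum_congr rfl fun b _ => isBlockConst_WbAdj (N := M * L) _ y' b' hb'
  have hI := isBlockConst_indicatorSum (d := d) M y
  intro y' b' hb'
  have hW' := hW y' b' hb'
  have hI' := hI y' b' hb'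
  simp only at hW' hI'
  simp only [Pi.smul_apply, Pi.add_apply, smul_eq_mul]
  rw [hW', hI']

omit [NeZero M] in
/-- [our proof] The block-summed force leg is curl-free. -/
theorem curv_blockSumMcol (y : AffineAveraging.Site (d + 1)) : curv (fun l x' => blockSum M (Mcol (N := N') l x') y) = 0 := by
  have hrw : (fun l x' => blockSum M (Mcol (N := N') l x') y)
      = dz (fun u => -∑ b ∈ box (d + 1) M, SbCol (N := N') ((M : ℤ) • y + toSite b) u) := by
    funext l x'
    rw [blockSum_Mcol_eq_neg_dz]
    simp only [dz]
    ring
  rw [hrw, curv_dz]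

omit [NeZero M] in
/-- [folklore] The block-summed force leg is bounded and summable componentwise. -/
theorem blockSumMcol_bdd_summable : ∃ C : ℝ, 0 ≤ C ∧
    (∀ (y : AffineAveraging.Site (d + 1)) l x', |blockSum M (Mcol (N := N') l x') y| ≤ C)
    ∧ ∀ (y : AffineAveraging.Site (d + 1)) l, Summable (fun x' => blockSum M (Mcol (N := N') l x') y) := by
  obtain ⟨C, hC, hb, hs⟩ := theta_bdd_summable (N' := N') (d := d) M
  refine ⟨2 * ((box (d + 1) M).card * C), by positivity, fun y l x' => ?_, fun y l => ?_⟩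
  · rw [blockSum_Mcol_eq_neg_dz, abs_neg]
    exact abs_dz_le (hb y) l x'
  · have h := (summable_dz (hs y) l).neg
    refine h.congr fun x' => ?_
    rw [blockSum_Mcol_eq_neg_dz]

end BlockSums

end Summit.QuantumFields.BalabanUV.Beta.FP.GaugeMultiplierBiLaplace

end
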